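import Mathlib
import HarnessLib
import Literature.MathematicalPhysics.QuantumLattice.HubbardBandShellVolume
import Summits.HubbardSuperconductivity.HubbardSuperconductivity.Theorems.KLProgrammePerturbedFermiCurveTransversalityAlternative
import Summits.HubbardSuperconductivity.HubbardSuperconductivity.Theorems.KLProgrammePerturbedFermiCurveCooperSlope

/-!
# Route `KLProgramme` — ENGINE child (stmt-HubbardSuperconductivity-20437 `KLRegimeEngineV17F2`): the TUBE REDUCTION of the frame's two-shell phase space to the angular
# sublevel set of the translated level (step (T3c); design note HOME/hubbard-kl-k3c2-p2/TWO-SHELL-FRAME-PORT.md §10)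

Cell `gate-hubbard-kl`, seat hubbard-kl-k3c2-p2 g15.  Frame twin of p1b's `klta_volume_twoShell_le` (…TwoPointLimitTwoShellArea): for the frame band `E = ε₀ + δ_K`
(`δ_K = −K.eval`, sizes `κ₀`, `κ₁ < Dt_min` on the square) and a level `ν` with `ν ± (κ₀ + ε₁)` admissible, the planar measure of
`{x ∈ [−π,π)² : |E(x) − ν| < ε₁, |E(x − w⃗) − ν| ≤ ε₂}` is at most `16Lε₁` times the measure of the angular set
`{θ ∈ (−π, π) : |E(p_ν(θ) − w⃗) − ν| ≤ ε₂ + (4 + κ₁)Lε₁}`, `L = 1/(Dt_min − κ₁)`, `p_ν = perturbedFermiRadius δ_K ν·dir`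
(**`volume_twoShell_le_frame`**): polar coordinates (`lintegral_comp_polarCoord_symm`), the radial window `|r − u_ν(θ)| ≤ Lε₁` (p4's `abs_radius_sub_root_le`),
the GLOBAL `(4 + κ₁)`-Lipschitz bound of `E` in sup norm (`abs_frameE_sub_le`, from the periodicity of `Dδ_K`: `norm_fderiv_negEval_le_all`), and `r ≤ 8` on the square.
Everything is PROVED; no definitions, no named facts; nothing asserts any stub or superconductivity.
References: DECOMP App. E Lemma E.1 (first display); BGM 2006 §2.4 Lemma 2.1 [cite: BenfattoGiulianiMastropietro2006]; FST II App. B [cite: FeldmanSalmhoferTrubowitz1998].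
-/

noncomputable section

namespace Summit.HubbardSuperconductivity.HubbardSuperconductivity.Theorems.PerturbedFermiCurve

set_option linter.dupNamespace false -- summit = problem name (single-conjunct summit), D-0017

open Real Set MeasureTheory
open scoped ENNReal
open Literature.MathematicalPhysics.QuantumLattice Literature.MathematicalPhysics.QuantumLattice.BandSectorCounting
open Literature.MathematicalPhysics.QuantumLattice.FermiRG
open Summit.HubbardSuperconductivity.HubbardSuperconductivity.Theorems.DispersionFlow
open Summit.HubbardSuperconductivity.HubbardSuperconductivity.Theorems.KLRegimeSplit

/-! ## §1 The frame shift is globally Lipschitz (periodicity of its derivative) -/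

/-- **`‖Dδ_K‖ ≤ κ₁` everywhere** once it holds on the closed square (`δ_K` is `2πℤ²`-periodic, hence so is `Dδ_K`). [folklore] -/
theorem norm_fderiv_negEval_le_all {K : TrigPolyC4v} {κ₁ : ℝ}
    (hκ : ∀ k : Fin 2 → ℝ, (∀ i, |k i| ≤ π) → ‖fderiv ℝ (fun k : Fin 2 → ℝ => -K.eval k) k‖ ≤ κ₁) (z : Fin 2 → ℝ) :
    ‖fderiv ℝ (fun k : Fin 2 → ℝ => -K.eval k) z‖ ≤ κ₁ := by
  obtain ⟨m, hm⟩ := exists_sub_int_mul_mem_square z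
  set c : Fin 2 → ℝ := fun i => (m i : ℝ) * (2 * π) with hc
  set z' : Fin 2 → ℝ := fun i => z i - m i * (2 * π) with hz'
  have hper : (fun k : Fin 2 → ℝ => -K.eval (k + c)) = fun k : Fin 2 → ℝ => -K.eval k := by
    funext k
    have h := TrigPolyC4v.eval_periodic K k m
    have e : (fun i => k i + (m i : ℤ) * (2 * Real.pi)) = k + c := by
      funext i; simp only [hc, Pi.add_apply]
    rw [e] at h; rw [h]
  have hzz : z' + c = z := by funext i; simp only [hz', hc, Pi.add_apply]; ring
  have key : fderiv ℝ (fun k : Fin 2 → ℝ => -K.eval k) z' = fderiv ℝ (fun k : Fin 2 → ℝ => -K.eval k) z := by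
    have h2 : fderiv ℝ (fun x : Fin 2 → ℝ => -K.eval (x + c)) z' = fderiv ℝ (fun y : Fin 2 → ℝ => -K.eval y) (z' + c) :=
      fderiv_comp_add_right (f := fun y : Fin 2 → ℝ => -K.eval y) c
    rw [hper, hzz] at h2
    exact h2
  rw [← key]
  exact hκ z' hm

/-- **`E = ε₀ + δ_K` is `(4 + κ₁)`-Lipschitz in sup norm on all of `ℝ²`.** [folklore] -/
theorem abs_frameE_sub_le {K : TrigPolyC4v} {κ₁ : ℝ}
    (hκ : ∀ k : Fin 2 → ℝ, (∀ i, |k i| ≤ π) → ‖fderiv ℝ (fun k : Fin 2 → ℝ => -K.eval k) k‖ ≤ κ₁) (x y : Fin 2 → ℝ) :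
    |(sqDispersion x + -K.eval x) - (sqDispersion y + -K.eval y)| ≤ (4 + κ₁) * ‖x - y‖ := by
  -- free part
  have h0 : |sqDispersion x - sqDispersion y| ≤ 4 * ‖x - y‖ := by
    have h := abs_eps2_sub_eps2_le (x 0) (x 1) (y 0) (y 1)
    have e : ∀ z : Fin 2 → ℝ, sqDispersion z = eps2 (z 0) (z 1) := fun z => by simp [sqDispersion, eps2]
    rw [e, e]
    have hx0 : |x 0 - y 0| ≤ ‖x - y‖ := by
      have := norm_le_pi_norm (x - y) 0; rwa [Pi.sub_apply, Real.norm_eq_abs] at this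
    have hx1 : |x 1 - y 1| ≤ ‖x - y‖ := by
      have := norm_le_pi_norm (x - y) 1; rwa [Pi.sub_apply, Real.norm_eq_abs] at this
    linarith
  -- frame part, mean value with the global derivative bound
  have hd : Differentiable ℝ (fun k : Fin 2 → ℝ => -K.eval k) :=
    (contDiff_frameShift_toLp K (m := 1)).differentiable one_ne_zero
  have h1 : |(-K.eval x) - (-K.eval y)| ≤ κ₁ * ‖x - y‖ := by
    have h := convex_univ.norm_image_sub_le_of_norm_fderiv_le (f := fun k : Fin 2 → ℝ => -K.eval k)
      (fun z _ => hd z) (fun z _ => norm_fderiv_negEval_le_all hκ z) (Set.mem_univ y) (Set.mem_univ x)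
    rw [Real.norm_eq_abs] at h
    exact h
  calc |(sqDispersion x + -K.eval x) - (sqDispersion y + -K.eval y)|
      = |(sqDispersion x - sqDispersion y) + ((-K.eval x) - (-K.eval y))| := by ring_nf
    _ ≤ |sqDispersion x - sqDispersion y| + |(-K.eval x) - (-K.eval y)| := abs_add_le _ _
    _ ≤ (4 + κ₁) * ‖x - y‖ := by linarith

/-! ## §2 The tube reduction -/

section Frame

variable {a b : ℝ} (B : BandBounds a b) {K : TrigPolyC4v} {κ₀ κ₁ : ℝ}
  (hδ : ∀ k : Fin 2 → ℝ, (∀ i, |k i| ≤ π) → |(fun k : Fin 2 → ℝ => -K.eval k) k| ≤ κ₀)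
  (hκ : ∀ k : Fin 2 → ℝ, (∀ i, |k i| ≤ π) → ‖fderiv ℝ (fun k : Fin 2 → ℝ => -K.eval k) k‖ ≤ κ₁) (hκ₁ : κ₁ < B.Dtmin)
include B hδ hκ hκ₁

/-- **Tube reduction of the frame's two-shell phase space** (see the module docstring). [cite: BenfattoGiulianiMastropietro2006, §2.4] -/
theorem volume_twoShell_le_frame (ν ε₁ ε₂ : ℝ) (wv : Fin 2 → ℝ) (hε₁ : 0 < ε₁) (hlo : a ≤ ν - κ₀ - ε₁) (hhi : ν + κ₀ + ε₁ ≤ b) :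
    volume {x : ℝ × ℝ | (x.1 ∈ Ico (-π) π ∧ x.2 ∈ Ico (-π) π) ∧
        |sqDispersion ![x.1, x.2] + -K.eval ![x.1, x.2] - ν| < ε₁ ∧
        |sqDispersion (![x.1, x.2] - wv) + -K.eval (![x.1, x.2] - wv) - ν| ≤ ε₂} ≤
      ENNReal.ofReal (16 * (1 / (B.Dtmin - κ₁)) * ε₁) *
        volume {θ ∈ Ioo (-π) π |
          |sqDispersion (perturbedFermiRadius (fun k : Fin 2 → ℝ => -K.eval k) ν θ • dir θ - wv) +
              -K.eval (perturbedFermiRadius (fun k : Fin 2 → ℝ => -K.eval k) ν θ • dir θ - wv) - ν| ≤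
            ε₂ + (4 + κ₁) * (1 / (B.Dtmin - κ₁)) * ε₁} := by
  set δK : (Fin 2 → ℝ) → ℝ := fun k : Fin 2 → ℝ => -K.eval k with hδK
  set u := perturbedFermiRadius δK ν with hudef
  set L := 1 / (B.Dtmin - κ₁) with hL
  have hD : 0 < B.Dtmin - κ₁ := sub_pos.2 hκ₁
  have hL0 : 0 ≤ L := by rw [hL]; positivity
  have hκ₀ : 0 ≤ κ₀ := by
    have h := hδ (fun _ => 0) (fun i => by simp [Real.pi_pos.le])
    exact (abs_nonneg _).trans h
  have hκ₁0 : 0 ≤ κ₁ := le_trans (norm_nonneg _) (hκ (fun _ => 0) (fun i => by simp [Real.pi_pos.le]))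
  have hlo' : a ≤ ν - κ₀ := by linarith
  have hhi' : ν + κ₀ ≤ b := by linarith
  have hδc : Continuous δK := (contDiff_frameShift_toLp K (m := 0)).continuous
  have hδs : ContDiff ℝ 2 δK := contDiff_frameShift_toLp K
  have hu : ∀ θ, IsBandFermiRadius (ν - δK (u θ • dir θ)) θ (u θ) := isBandFermiRadius_perturbedFermiRadius B hδc hδ hlo' hhi'
  have h2ne : (2 : WithTop ℕ∞) ≠ 0 := by norm_num
  have hucont : Continuous u := (contDiff_of_isRoot B hδs h2ne hδ hlo' hhi' hκ hκ₁ hu).continuous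
  have hdiff : ∀ q : Fin 2 → ℝ, (∀ i, |q i| ≤ π) → DifferentiableAt ℝ δK q := fun q _ =>
    ((contDiff_frameShift_toLp K (m := 1)).differentiable one_ne_zero) q
  have hLip : ∀ q q' : Fin 2 → ℝ, (∀ i, |q i| ≤ π) → (∀ i, |q' i| ≤ π) → |δK q - δK q'| ≤ κ₁ * ‖q - q'‖ :=
    fun q q' hq hq' => lipschitz_of_fderiv_le hdiff hκ hq hq'
  -- the sets
  set E' : Set (ℝ × ℝ) := {x : ℝ × ℝ | (x.1 ∈ Ico (-π) π ∧ x.2 ∈ Ico (-π) π) ∧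
      |sqDispersion ![x.1, x.2] + -K.eval ![x.1, x.2] - ν| < ε₁ ∧
      |sqDispersion (![x.1, x.2] - wv) + -K.eval (![x.1, x.2] - wv) - ν| ≤ ε₂} with hE'
  set δ' := ε₂ + (4 + κ₁) * L * ε₁ with hδ'
  set G : ℝ → ℝ := fun θ => sqDispersion (u θ • dir θ - wv) + -K.eval (u θ • dir θ - wv) - ν with hGdef
  set Θ : Set ℝ := {θ ∈ Ioo (-π) π | |G θ| ≤ δ'} with hΘ
  -- measurability
  have hvec : Continuous fun x : ℝ × ℝ => (![x.1, x.2] : Fin 2 → ℝ) := by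
    refine continuous_pi fun i => ?_
    fin_cases i
    · simpa using continuous_fst
    · simpa using continuous_snd
  have hEc : Continuous fun k : Fin 2 → ℝ => sqDispersion k + -K.eval k :=
    (contDiff_one_sqDispersion.continuous).add hδc
  have hE'm : MeasurableSet E' := by
    have h1 : MeasurableSet {x : ℝ × ℝ | x.1 ∈ Ico (-π) π ∧ x.2 ∈ Ico (-π) π} := by
      have : {x : ℝ × ℝ | x.1 ∈ Ico (-π) π ∧ x.2 ∈ Ico (-π) π} = Ico (-π) π ×ˢ Ico (-π) π := by
        ext x; simp [mem_prod]
      rw [this]; exact measurableSet_Ico.prod measurableSet_Ico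
    have hc1 : Continuous fun x : ℝ × ℝ => |sqDispersion ![x.1, x.2] + -K.eval ![x.1, x.2] - ν| :=
      ((hEc.comp hvec).sub continuous_const).abs
    have hc2 : Continuous fun x : ℝ × ℝ => |sqDispersion (![x.1, x.2] - wv) + -K.eval (![x.1, x.2] - wv) - ν| :=
      ((hEc.comp (hvec.sub continuous_const)).sub continuous_const).abs
    have hset : E' = {x : ℝ × ℝ | x.1 ∈ Ico (-π) π ∧ x.2 ∈ Ico (-π) π} ∩
        ({x | |sqDispersion ![x.1, x.2] + -K.eval ![x.1, x.2] - ν| < ε₁} ∩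
         {x | |sqDispersion (![x.1, x.2] - wv) + -K.eval (![x.1, x.2] - wv) - ν| ≤ ε₂}) := by
      ext x; simp only [hE', mem_setOf_eq, mem_inter_iff]
    rw [hset]
    exact h1.inter ((measurableSet_lt hc1.measurable measurable_const).inter (measurableSet_le hc2.measurable measurable_const))
  have hGc : Continuous G := by
    have hcurve : Continuous fun θ => u θ • dir θ - wv := (hucont.smul (contDiff_dir (n := 0)).continuous).sub continuous_const
    exact (hEc.comp hcurve).sub continuous_const
  have hΘm : MeasurableSet Θ := by
    have hset : Θ = Ioo (-π) π ∩ {θ | |G θ| ≤ δ'} := by ext θ; simp only [hΘ, mem_setOf_eq, mem_inter_iff]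
    rw [hset]
    exact measurableSet_Ioo.inter (measurableSet_le hGc.abs.measurable measurable_const)
  -- the window set in polar coordinates
  set Wset : Set (ℝ × ℝ) := {q : ℝ × ℝ | (u q.2 - L * ε₁ ≤ q.1 ∧ q.1 ≤ u q.2 + L * ε₁) ∧ q.2 ∈ Θ} with hWset
  have hWm : MeasurableSet Wset := by
    have hc1 : Measurable fun q : ℝ × ℝ => u q.2 - L * ε₁ := (hucont.measurable.comp measurable_snd).sub_const _
    have hc2 : Measurable fun q : ℝ × ℝ => u q.2 + L * ε₁ := (hucont.measurable.comp measurable_snd).add_const _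
    exact ((measurableSet_le hc1 measurable_fst).inter (measurableSet_le measurable_fst hc2)).inter (measurable_snd hΘm)
  set g : ℝ × ℝ → ℝ≥0∞ := fun q => ENNReal.ofReal 8 * Wset.indicator (fun _ => (1 : ℝ≥0∞)) q with hg
  have hgm : Measurable g := (measurable_const.indicator hWm).const_mul _
  -- polar coordinates and the pointwise bound
  have hpolar : volume E' = ∫⁻ q in polarCoord.target,
      ENNReal.ofReal q.1 • E'.indicator (1 : ℝ × ℝ → ℝ≥0∞) (polarCoord.symm q) := by
    rw [lintegral_comp_polarCoord_symm (E'.indicator 1), lintegral_indicator_one hE'm]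
  have hpt : ∀ q ∈ polarCoord.target,
      ENNReal.ofReal q.1 • E'.indicator (1 : ℝ × ℝ → ℝ≥0∞) (polarCoord.symm q) ≤ g q := by
    rintro ⟨r, θ⟩ hq
    simp only [polarCoord_target, mem_prod, mem_Ioi, mem_Ioo] at hq
    by_cases hmem : polarCoord.symm (r, θ) ∈ E'
    · rw [indicator_of_mem hmem, Pi.one_apply, smul_eq_mul, mul_one]
      simp only [polarCoord_symm_apply] at hmem
      obtain ⟨⟨hx, hy⟩, hε, hε₂⟩ := hmem
      set k : Fin 2 → ℝ := ![r * Real.cos θ, r * Real.sin θ] with hkdef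
      have hkeq : k = r • dir θ := by funext i; fin_cases i <;> simp [hkdef, dir]
      have hk : ∀ i, |k i| ≤ π := by
        intro i; fin_cases i
        · simpa [hkdef] using (abs_le.2 ⟨hx.1, hx.2.le⟩ : |r * Real.cos θ| ≤ π)
        · simpa [hkdef] using (abs_le.2 ⟨hy.1, hy.2.le⟩ : |r * Real.sin θ| ≤ π)
      have hx' : |r * Real.cos θ| ≤ π := abs_le.2 ⟨hx.1, hx.2.le⟩
      have hy' : |r * Real.sin θ| ≤ π := abs_le.2 ⟨hy.1, hy.2.le⟩
      have hr8 : r ≤ 8 := (polar_mem_square_bounds hq.1 hx' hy').2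
      have hshell : |sqDispersion k + δK k - ν| ≤ ε₁ := hε.le
      -- the polar angle of `k` is `θ`
      have harg : Complex.arg (⟨k 0, k 1⟩ : ℂ) = θ := by
        have e : (⟨k 0, k 1⟩ : ℂ) = r * (Complex.cos θ + Complex.sin θ * Complex.I) := by
          apply Complex.ext <;> simp [hkdef, Complex.cos_ofReal_re, Complex.sin_ofReal_re]
        rw [e]
        exact Complex.arg_mul_cos_add_sin_mul_I hq.1 ⟨hq.2.1, hq.2.2.le⟩
      -- `r` is the free radius of `k` at angle `θ`
      have hνk : sqDispersion k ∈ Icc a b := by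
        have h1 := abs_le.1 hshell; have h2 := abs_le.1 (hδ k hk)
        constructor <;> linarith
      have hkfree := eq_bandFermiRadius_smul_dir_of_mem_square B hk hνk 0
      rw [harg, Int.cast_zero, zero_mul, add_zero] at hkfree
      have hrR : bandFermiRadius (sqDispersion k) θ = r := by
        have h0 : k 0 = bandFermiRadius (sqDispersion k) θ * Real.cos θ := by
          have := congrFun hkfree 0; simpa [dir] using this
        have h1 : k 1 = bandFermiRadius (sqDispersion k) θ * Real.sin θ := by
          have := congrFun hkfree 1; simpa [dir] using this
        have e0 : k 0 = r * Real.cos θ := by simp [hkdef]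
        have e1 : k 1 = r * Real.sin θ := by simp [hkdef]
        have hcs := Real.cos_sq_add_sin_sq θ
        have hc' : bandFermiRadius (sqDispersion k) θ * Real.cos θ = r * Real.cos θ := by rw [← h0, e0]
        have hs' : bandFermiRadius (sqDispersion k) θ * Real.sin θ = r * Real.sin θ := by rw [← h1, e1]
        linear_combination Real.cos θ * hc' + Real.sin θ * hs' + (r - bandFermiRadius (sqDispersion k) θ) * hcs
      -- the radial window
      have hrad := abs_radius_sub_root_le B hδ hLip hκ₁ hu hk hshell hlo hhi 0
      rw [harg, Int.cast_zero, zero_mul, add_zero, hrR] at hrad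
      have hru : |r - u θ| ≤ L * ε₁ := by rw [hL]; rw [one_div_mul_eq_div]; exact hrad
      -- the angle lies in `Θ`
      have hdist : ‖(k - wv) - (u θ • dir θ - wv)‖ ≤ L * ε₁ := by
        rw [show (k - wv) - (u θ • dir θ - wv) = (r - u θ) • dir θ by rw [hkeq, sub_smul]; abel]
        rw [norm_smul, Real.norm_eq_abs]
        exact (mul_le_of_le_one_right (abs_nonneg _) (norm_dir_le_one θ)).trans hru
      have hcmp := abs_frameE_sub_le hκ (k - wv) (u θ • dir θ - wv)
      have hε₂' : |sqDispersion (k - wv) + -K.eval (k - wv) - ν| ≤ ε₂ := hε₂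
      have hθΘ : θ ∈ Θ := by
        refine ⟨hq.2, ?_⟩
        show |sqDispersion (u θ • dir θ - wv) + -K.eval (u θ • dir θ - wv) - ν| ≤ δ'
        have htri := abs_sub_abs_le_abs_sub (sqDispersion (u θ • dir θ - wv) + -K.eval (u θ • dir θ - wv) - ν)
          (sqDispersion (k - wv) + -K.eval (k - wv) - ν)
        rw [show sqDispersion (u θ • dir θ - wv) + -K.eval (u θ • dir θ - wv) - ν - (sqDispersion (k - wv) + -K.eval (k - wv) - ν) =
            -((sqDispersion (k - wv) + -K.eval (k - wv)) - (sqDispersion (u θ • dir θ - wv) + -K.eval (u θ • dir θ - wv))) by ring,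
          abs_neg] at htri
        have h45 : (4 + κ₁) * ‖(k - wv) - (u θ • dir θ - wv)‖ ≤ (4 + κ₁) * L * ε₁ := by
          have := mul_le_mul_of_nonneg_left hdist (by linarith : (0:ℝ) ≤ 4 + κ₁); linarith
        rw [hδ']
        linarith
      rw [hg]
      simp only
      have hwin : u θ - L * ε₁ ≤ r ∧ r ≤ u θ + L * ε₁ := by
        obtain ⟨h1, h2⟩ := abs_le.1 hru; constructor <;> linarith
      rw [indicator_of_mem (show ((r, θ) : ℝ × ℝ) ∈ Wset from ⟨hwin, hθΘ⟩), mul_one]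
      exact ENNReal.ofReal_le_ofReal hr8
    · rw [indicator_of_notMem hmem, smul_zero]
      exact bot_le
  -- integrate the bound
  have hI : ∫⁻ q in polarCoord.target, g q ≤ ENNReal.ofReal (16 * L * ε₁) * volume Θ := by
    rw [polarCoord_target, show (volume : Measure (ℝ × ℝ)) = (volume : Measure ℝ).prod volume from rfl,
      ← Measure.prod_restrict, lintegral_prod_symm _ hgm.aemeasurable]
    have hinner : ∀ θ ∈ Ioo (-π) π, ∫⁻ r in Ioi (0 : ℝ), g (r, θ) ≤
        ENNReal.ofReal (8 * (L * (2 * ε₁))) * Θ.indicator 1 θ := by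
      intro θ _
      by_cases hθΘ : θ ∈ Θ
      · have hgr : ∀ r, g (r, θ) = ENNReal.ofReal 8 * (Icc (u θ - L * ε₁) (u θ + L * ε₁)).indicator 1 r := fun r => by
          simp only [hg, hWset, indicator, mem_setOf_eq, mem_Icc, Pi.one_apply, hθΘ, and_true]
        rw [indicator_of_mem hθΘ, Pi.one_apply, mul_one]
        calc ∫⁻ r in Ioi (0 : ℝ), g (r, θ)
            ≤ ∫⁻ r, g (r, θ) := lintegral_mono' Measure.restrict_le_self le_rfl
          _ = ENNReal.ofReal 8 * volume (Icc (u θ - L * ε₁) (u θ + L * ε₁)) := by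
              simp_rw [hgr]
              rw [lintegral_const_mul' _ _ ENNReal.ofReal_ne_top, lintegral_indicator_one measurableSet_Icc]
          _ = ENNReal.ofReal 8 * ENNReal.ofReal (u θ + L * ε₁ - (u θ - L * ε₁)) := by rw [Real.volume_Icc]
          _ = ENNReal.ofReal 8 * ENNReal.ofReal (L * (2 * ε₁)) := by congr 2; ring
          _ = ENNReal.ofReal (8 * (L * (2 * ε₁))) := (ENNReal.ofReal_mul (by norm_num)).symm
      · have hgr : ∀ r, g (r, θ) = 0 := fun r => by
          simp only [hg, hWset, indicator, mem_setOf_eq, hθΘ, and_false, if_false, mul_zero]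
        simp_rw [hgr]
        rw [lintegral_zero]
        exact bot_le
    have hΘi : Measurable fun θ => ENNReal.ofReal (8 * (L * (2 * ε₁))) * Θ.indicator (1 : ℝ → ℝ≥0∞) θ :=
      (measurable_const.indicator hΘm).const_mul _
    calc ∫⁻ θ in Ioo (-π) π, ∫⁻ r in Ioi (0 : ℝ), g (r, θ)
        ≤ ∫⁻ θ in Ioo (-π) π, ENNReal.ofReal (8 * (L * (2 * ε₁))) * Θ.indicator 1 θ := setLIntegral_mono hΘi hinner
      _ ≤ ∫⁻ θ, ENNReal.ofReal (8 * (L * (2 * ε₁))) * Θ.indicator 1 θ := lintegral_mono' Measure.restrict_le_self le_rfl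
      _ = ENNReal.ofReal (8 * (L * (2 * ε₁))) * volume Θ := by
          rw [lintegral_const_mul' _ _ ENNReal.ofReal_ne_top, lintegral_indicator_one hΘm]
      _ = ENNReal.ofReal (16 * L * ε₁) * volume Θ := by congr 1; congr 1; ring
  calc volume E' = ∫⁻ q in polarCoord.target,
        ENNReal.ofReal q.1 • E'.indicator (1 : ℝ × ℝ → ℝ≥0∞) (polarCoord.symm q) := hpolar
    _ ≤ ∫⁻ q in polarCoord.target, g q := setLIntegral_mono hgm hpt
    _ ≤ ENNReal.ofReal (16 * L * ε₁) * volume Θ := hI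

end Frame

end Summit.HubbardSuperconductivity.HubbardSuperconductivity.Theorems.PerturbedFermiCurve

end
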